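import Mathlib
import Literature.NumberTheory.LFunctions.Zhang2022.Section16U041Residues
import Literature.NumberTheory.LFunctions.Zhang2022.Section16U041ResBeta
import Literature.NumberTheory.LFunctions.Zhang2022.Section16BU041Contour
import HarnessLib

/-!
# Zhang (2022) §16 p. 94, the repaired u041a (`Typed.Section16B.Step16_u041aR`, row G-d57-1):
# assembly of the contour shift and the two residues — ZHANG-L WP16 block C closer (parts form)

Topic `Literature/NumberTheory/LFunctions/Zhang2022` (Landau–Siegel audit tree; verdict-neutral).
Y. Zhang, *Discrete mean estimates and the Landau–Siegel zero*, arXiv:2211.02515v1 (2022)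
[Zhang2022LandauSiegel] — **an unrefereed manuscript under adjudication**; nothing here asserts or denies
its Theorems 1–2. §16 p. 94, tex L4662–L4664: "The contour of integration is moved in the same way as in
the proof of Lemma 8.4. Thus the right side above is, by Lemma 16.2, equal to `L′(1,χ)³𝔲₂ⱼ(1) + O(1/𝓛⁴)`."
At the repaired normaliser of row G-d57-1 the typed node is `Step16_u041aR c′`:
`(1/2π)∫_ℝ integrand16_u040R(1+iv)dv = L′(1,χ)³E₂ⱼ(1) + O((1+|L′(1,χ)|)³𝓛⁻⁴)`.

This file is the block-C CLOSER IN PARTS FORM (owner zl-libC-p1; carve of 2026-08-27T01:33Z): it fixes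
the three seams as Lean text and proves that they compose to the node BY NAME —

* (C2) the contour shift (zl-libC-p5, `GaussKernelContour` engine with `Y = T`, kernel pole `β = 0`,
  `σ₀ = 1`, `a = −1/20`, poles `S = {0, βⱼ}` of orders `3, 1`):
  `‖(1/2π)∫ integrand16_u040R(1+iv)dv − (Res₀ + Res_{βⱼ})‖ ≤ 𝓛⁻⁵` with
  `Res₀ = ((swap dslope 0)^[2] φ₀)(0)`, `Res_{βⱼ} = φ_β(βⱼ)`, where
  `φ₀(z) = ζ₁(1+z)²·((ζ(1+z−βⱼ)L(1+z,χ)L(1+z−βⱼ,χ)²)·E₂ⱼ(1+z))·(Tᶻω₁(z))` and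
  `φ_β(z) = ζ(1+z)²ζ₁(1+z−βⱼ)L(1+z,χ)L(1+z−βⱼ,χ)²E₂ⱼ(1+z)·(Tᶻω₁(z)/z)`;
* (C1) the residue at the triple pole (this seat, `U041.norm_res0_sub_main_le`):
  `‖Res₀ − L′(1,χ)³E₂ⱼ(1)‖ ≤ C(1+|L′|)³𝓛⁻⁴`;
* (C4) the residue at the simple pole `βⱼ` (zl-w09-p3, it carries `L(1,χ)²`): `‖Res_{βⱼ}‖ ≤ 𝓛⁻⁴`;

`step16_u041aR_of_parts`: (C2) ∧ (C1) ∧ (C4) ⇒ `Step16_u041aR c′` (triangle inequality). The final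
closer `step16_u041aR_of_lemma162Rq (hRq : Lemma162Rq c′)` is appended once (C2) and (C4) land. NOT
a statement of the manuscript; no new `def`.

## References
* Y. Zhang, arXiv:2211.02515v1 (2022), §16 p. 94, tex L4655–L4665; §8 proof of Lemma 8.4 p. 45.
  [cite: Zhang2022LandauSiegel, §16 p.94]
-/

noncomputable section

open Complex Real Set Filter Topology Metric MeasureTheory

namespace Literature.NumberTheory.LFunctions.Zhang2022.Typed.Section16B

open Literature.NumberTheory.LFunctions.Zhang2022
open Literature.NumberTheory.LFunctions.Zhang2022.Skeleton
open Literature.NumberTheory.LFunctions.Zhang2022.Typed.Section16A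
open GaussWeight

/-- **Block C in parts ⇒ `Step16_u041aR`** (§16 p. 94 repaired u041a): if for all large `D`, under (A),
`j = 1, 2`, (C2) the contour shift leaves `(1/2π)∫ integrand16_u040R(1+iv)dv = Res₀ + Res_{βⱼ} + O(𝓛⁻⁵)`
in the engine's pole-datum format, (C1) `Res₀ = L′(1,χ)³E₂ⱼ(1) + O((1+|L′|)³𝓛⁻⁴)` and (C4)
`Res_{βⱼ} = O(𝓛⁻⁴)`, then `Step16_u041aR c′` holds (constant `C + 2`).
[cite: Zhang2022LandauSiegel, §16 p.94] -/
theorem step16_u041aR_of_parts (c' : ℝ)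
    (hcontour : ForAllLarge fun D _ χ => AssumptionA D χ → ∀ j ∈ ({1, 2} : Finset ℕ),
      ‖(1 / (2 * π) : ℂ) * (∫ v : ℝ, integrand16_u040R c' χ j (1 + v * I)) -
          ((Function.swap dslope (0 : ℂ))^[2]
              (fun z : ℂ => riemannZeta₁ (1 + z) ^ 2 *
                ((riemannZeta (1 + z - betaJ c' D j) * χ.LFunction (1 + z) *
                    χ.LFunction (1 + z - betaJ c' D j) ^ 2) * frakU2R c' χ j (1 + z)) *
                (((bigT D : ℝ) : ℂ) ^ z * omega1 (ell D ^ 30) z)) 0 +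
            (fun z : ℂ => riemannZeta (1 + z) ^ 2 * riemannZeta₁ (1 + z - betaJ c' D j) *
                χ.LFunction (1 + z) * χ.LFunction (1 + z - betaJ c' D j) ^ 2 * frakU2R c' χ j (1 + z) *
                (((bigT D : ℝ) : ℂ) ^ z * omega1 (ell D ^ 30) z / z)) (betaJ c' D j))‖ ≤
        (ell D ^ 5)⁻¹)
    (hres0 : ∃ C : ℝ, 0 ≤ C ∧ ForAllLarge fun D _ χ => AssumptionA D χ → ∀ j ∈ ({1, 2} : Finset ℕ),
      ‖(Function.swap dslope (0 : ℂ))^[2]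
          (fun z : ℂ => riemannZeta₁ (1 + z) ^ 2 *
            ((riemannZeta (1 + z - betaJ c' D j) * χ.LFunction (1 + z) *
                χ.LFunction (1 + z - betaJ c' D j) ^ 2) * frakU2R c' χ j (1 + z)) *
            (((bigT D : ℝ) : ℂ) ^ z * omega1 (ell D ^ 30) z)) 0 -
          deriv χ.LFunction 1 ^ 3 * frakU2R c' χ j 1‖ ≤
        C * (1 + ‖deriv χ.LFunction 1‖) ^ 3 * (ell D ^ 4)⁻¹)
    (hresβ : ForAllLarge fun D _ χ => AssumptionA D χ → ∀ j ∈ ({1, 2} : Finset ℕ),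
      ‖(fun z : ℂ => riemannZeta (1 + z) ^ 2 * riemannZeta₁ (1 + z - betaJ c' D j) *
          χ.LFunction (1 + z) * χ.LFunction (1 + z - betaJ c' D j) ^ 2 * frakU2R c' χ j (1 + z) *
          (((bigT D : ℝ) : ℂ) ^ z * omega1 (ell D ^ 30) z / z)) (betaJ c' D j)‖ ≤ (ell D ^ 4)⁻¹) :
    Step16_u041aR c' := by
  obtain ⟨C, hC0, h0⟩ := hres0
  refine ⟨C + 2, ?_⟩
  have h3 : ForAllLarge fun D _ _ => (3 : ℕ) ≤ D := ForAllLarge.of_le 3 fun D _ _ hD _ _ => hD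
  refine (((hcontour.and h0).and hresβ).and h3).mono fun D _ χ _ _ hh hA j hj => ?_
  obtain ⟨⟨⟨hc, hr0⟩, hrβ⟩, hD3⟩ := hh
  have hℓ1 : 1 ≤ ell D := (one_lt_ell hD3).le
  have hℓ0 : 0 < ell D := by linarith
  specialize hc hA j hj
  specialize hr0 hA j hj
  specialize hrβ hA j hj
  -- names
  set Iv := (1 / (2 * π) : ℂ) * (∫ v : ℝ, integrand16_u040R c' χ j (1 + v * I)) with hIv
  set R₀ := (Function.swap dslope (0 : ℂ))^[2]
      (fun z : ℂ => riemannZeta₁ (1 + z) ^ 2 *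
        ((riemannZeta (1 + z - betaJ c' D j) * χ.LFunction (1 + z) *
            χ.LFunction (1 + z - betaJ c' D j) ^ 2) * frakU2R c' χ j (1 + z)) *
        (((bigT D : ℝ) : ℂ) ^ z * omega1 (ell D ^ 30) z)) 0 with hR₀
  set Rβ := (fun z : ℂ => riemannZeta (1 + z) ^ 2 * riemannZeta₁ (1 + z - betaJ c' D j) *
      χ.LFunction (1 + z) * χ.LFunction (1 + z - betaJ c' D j) ^ 2 * frakU2R c' χ j (1 + z) *
      (((bigT D : ℝ) : ℂ) ^ z * omega1 (ell D ^ 30) z / z)) (betaJ c' D j) with hRβ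
  set m := deriv χ.LFunction 1 ^ 3 * frakU2R c' χ j 1 with hm
  set ℓ := ‖deriv χ.LFunction 1‖ with hℓ
  have e : Iv - m = (Iv - (R₀ + Rβ)) + (R₀ - m) + Rβ := by ring
  rw [e]
  have h5 : (ell D ^ 5)⁻¹ ≤ (ell D ^ 4)⁻¹ := by
    rw [inv_le_inv₀ (by positivity) (by positivity)]
    exact pow_le_pow_right₀ hℓ1 (by norm_num)
  have h1ℓ : (1 : ℝ) ≤ (1 + ℓ) ^ 3 := one_le_pow₀ (by simp only [hℓ]; linarith [norm_nonneg (deriv χ.LFunction 1)])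
  have hpos : 0 ≤ (ell D ^ 4)⁻¹ := by positivity
  calc ‖(Iv - (R₀ + Rβ)) + (R₀ - m) + Rβ‖ ≤ ‖Iv - (R₀ + Rβ)‖ + ‖R₀ - m‖ + ‖Rβ‖ := norm_add₃_le
    _ ≤ (ell D ^ 5)⁻¹ + C * (1 + ℓ) ^ 3 * (ell D ^ 4)⁻¹ + (ell D ^ 4)⁻¹ := by
        gcongr
    _ ≤ 1 * (1 + ℓ) ^ 3 * (ell D ^ 4)⁻¹ + C * (1 + ℓ) ^ 3 * (ell D ^ 4)⁻¹ +
          1 * (1 + ℓ) ^ 3 * (ell D ^ 4)⁻¹ := by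
        gcongr
        · calc (ell D ^ 5)⁻¹ ≤ (ell D ^ 4)⁻¹ := h5
            _ = 1 * 1 * (ell D ^ 4)⁻¹ := by ring
            _ ≤ 1 * (1 + ℓ) ^ 3 * (ell D ^ 4)⁻¹ := by gcongr
        · calc (ell D ^ 4)⁻¹ = 1 * 1 * (ell D ^ 4)⁻¹ := by ring
            _ ≤ 1 * (1 + ℓ) ^ 3 * (ell D ^ 4)⁻¹ := by gcongr
    _ = (C + 2) * (1 + ℓ) ^ 3 * (ell D ^ 4)⁻¹ := by ring

/-! ### The closer (appended once (C2) `u041_contour` p485522 and (C4) `U041.norm_resBeta_le` p484805 landed) -/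

/-- **§16 p. 94, the repaired u041a, FROM the repaired Lemma 16.2 with explicit bounds**: for every
`c′`, `Lemma162Rq c′ → Step16_u041aR c′`, i.e. for all large `D`, under (A), `j = 1, 2`,
`(1/2π)∫_ℝ ζ(2+iv)²ζ(2+iv−βⱼ)L(2+iv,χ)L(2+iv−βⱼ,χ)²E₂ⱼ(2+iv)T^{1+iv}ω₁(1+iv)/(1+iv) dv
 = L′(1,χ)³E₂ⱼ(1) + O((1+|L′(1,χ)|)³𝓛⁻⁴)` — the step "the contour of integration is moved in the same
way as in the proof of Lemma 8.4 … = L′(1,χ)³𝔲₂ⱼ(1) + O(1/𝓛⁴)" (tex L4662–L4664) at the repaired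
normaliser of row G-d57-1. Composition of ZHANG-L WP16 block C: (C2) `u041_contour` (zl-libC-p5: Landau
contour via `GaussKernelContour`, `a = −1/20`, poles `{0, βⱼ}`), (C1) `U041.norm_res0_sub_main_le`
(triple-pole residue), (C4) `U041.norm_resBeta_le'` (zl-w09-p3: simple pole at `βⱼ`, carries `L(1,χ)²`).
With WP09's `lemma162Rq_holds` this is the `h41a` input of `eq16_16R2E_of_u037RLE_u041aR_lemma162Rq`
(leaf h16_16). [cite: Zhang2022LandauSiegel, §16 p.94] -/
theorem step16_u041aR_of_lemma162Rq (c' : ℝ) (hRq : Lemma162Rq c') : Step16_u041aR c' :=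
  step16_u041aR_of_parts c' (u041_contour c' hRq) (U041.norm_res0_sub_main_le c' hRq)
    (U041.norm_resBeta_le' c' hRq)

end Literature.NumberTheory.LFunctions.Zhang2022.Typed.Section16B
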